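import Summits.QuantumFields.YangMills.Theorems.BalabanUVNodesN15ColouredLiveBackgroundMatrixObjects
import HarnessLib

/-!
# N15 = NE2 — PROGRAMME Q «COVARIANT AVERAGE IN THE SANDWICH», part (Q-2a): THE COVARIANTLY AVERAGED LIVE BACKGROUND MATRICES `zCovC`, `zCovF` — the site∕unit middle factor with the
# averaging `Q ⊗ 1 + D`, `Q* ⊗ 1 + E` for ANY perturbations `D, E` of [B9] (3.81)'s shape — their honest dictionary, and two scalar amplitude budgets for (Q-2b)
# (dag-n15-a g31, FILE (Q-2a); node N15 = NE2; `--supports stmt-QuantumFields-27366 --as helper`, count-neutral; 2 plumbing defs + theorems; imports (J-b′))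

WHY.  [B9] Thm 3.2 (3.48) p.398 sandwiches the propagator with the COVARIANT averaging `Q′(U)` ((3.19): block sums with the transports `R(U(Γ_{y,x}))` along contours; for 1-forms [5] (124)),
and §C p.406 (3.78)–(3.81) prints `Q_j(U′U) = Q_j(U) + F₂,ⱼ(A)` with `|F₂,ⱼ(A)A′| ≤ O(1)·α₁·Q″_j|A′|` (majorant `Q″_j` = [5] (140)–(141); v1.0.1 doc-only: v1.0 printed `Q′_j`, corrected after lit-balaban r06's first-hand reading) — at `U = 1`: the covariant average is the FLAT one plus a small semi-local perturbation
of the size of the field.  This lane's U-live site∕unit middle factor (J-b′) `zLiveC∕F(A′) = unitBondMatC((Q⊗1)(X(A′) − G⊗1)(Q*⊗1))` averages FLATLY.  This file defines the middle factor with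
the averaging maps `Q⊗1 + D` and `Q*⊗1 + E` — `zCovC A′ D E := zLiveC A′ + unitBondMatC(D∘X∘(Q*⊗1 + E)) + unitBondMatC((Q⊗1)∘X∘E)` — proves the honest dictionary ★ `zCovC_eq` (it IS
`unitBondMatC((Q⊗1 + D)∘X∘(Q*⊗1 + E) − (Q⊗1)(G⊗1)(Q*⊗1))`), `zCovC_zero_zero` (at `D = E = 0` it is `zLiveC`), and two SCALAR amplitude budgets used by (Q-2b)'s letters (kept out of the operator
context: `nlinarith` in that context times out on the atom comparison — noted for successors).  The perturbation `D` of [5] (124) ∕ [B9] (3.80) is NOT constructed here (n15-c∕181 `qvCov`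
is the object; MISSING ESTIMATE N15 asked 2026-08-29 12:39Z).

HONEST FRAMING ∕ LIMITS.  Definitions + linear algebra + scalar arithmetic; the covariant averaging is MODELLED as `Q⊗1 + D` — [5] (124) NOT typed, no transport along contours constructed here;
MODEL objects of n15-c FILE 130∕133 (global small-field gauge `u ≡ 1`; covariant Laplacian (3.50) ⊗ colour + FLAT nonlocal part (1.69) — not (3.26); `Reg336` idle; doubled torus; `L ≥ 7`);
no layer of NE2 proved here; NOT [B9] Thms 3.1∕3.2∕3.15 AS PRINTED; N15 stays DISCHARGED OF RECORD AS CONSUMED (U-blind v7 pin, p687738), nothing re-claimed, no count moved; finite 𝕋⁴ per index —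
NOT ℝ⁴ ∕ OS ∕ mass gap ∕ Clay.  Two plumbing `def`s ⇒ review ∕ audit lane.  `set_option maxRecDepth 8192 in` ×2 (one unfolding of (J-b′)'s names, their declared budget).  No `sorry`, `instance`,
`notation`; standard axioms.
[cite: Balaban1985BackgroundPropagators, Thm 3.2 (3.48) p.398 (the covariant sandwich), (3.19) p.393 (covariant average), (3.78)–(3.81) p.406 (its background dependence); Balaban1985Averaging, Prop. 3 (122)–(126) p.36 (the linear part of the
averaging, NOT typed); Balaban1984PropagatorsI, (1.18) p.20, (1.102)–(1.103) p.34]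
-/

noncomputable section

open scoped BigOperators Matrix Matrix.Norms.Frobenius

namespace Summit.QuantumFields.YangMills.BalabanUVNodes.N15.GluedZeroField

open Literature.MathematicalPhysics.QuantumFieldTheory.Balaban1983to89
open Literature.MathematicalPhysics.QuantumFieldTheory.Balaban1983to89.B5Prop11Plancherel (Tor fine)
open Literature.MathematicalPhysics.QuantumFieldTheory.Balaban1983to89.B6Lemma24Torus (pbox)
open Literature.Barriers.QuantumFields (traceForm)
open Summit.QuantumFields.YangMills.BalabanUVNodes.N15.BackgroundLayer (gavgM)
open Summit.QuantumFields.YangMills.BalabanUVNodes.N15.VectorPiece (bshiftEquiv kingPrV tensorId)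
open Summit.QuantumFields.YangMills.BalabanUVNodes.N15.TwoGrid (gOp qvRe qvAdjRe)
open Summit.QuantumFields.YangMills.BalabanUVNodes.N15.UnitLayerBgCol (unitBondMatC unitBondMatC_add unitBondMatC_sub unitBondMatC_zero cdist)
open Summit.QuantumFields.YangMills.BalabanUVNodes.N15.Gluing (cvM CvX CvX' cvNL cvNL' cvGlued cvGlued')

variable (d : ℕ) {L : ℕ} [NeZero L] (mm ι : Type) [Fintype mm] [DecidableEq mm] [Fintype ι] [DecidableEq ι] (a : ℝ) (e : Matrix mm mm ℂ ≃L[ℝ] (ι → ℝ))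

/-! ## §1 The covariantly averaged live background matrices -/

/-- **THE COVARIANTLY AVERAGED LIVE BACKGROUND MATRIX, COARSE SPACING**, for averaging perturbations `D` (of `Q ⊗ 1_ι`) and `E` (of `Q* ⊗ 1_ι`):
`zCovC A′ D E := zLiveC A′ + unitBondMatC(D ∘ X(e^{ηĀ′}) ∘ (Q*⊗1 + E)) + unitBondMatC((Q⊗1) ∘ X(e^{ηĀ′}) ∘ E)` — by `zCovC_eq` the middle factor `unitBondMatC((Q⊗1 + D) X (Q*⊗1 + E) − (Q⊗1)(G⊗1)(Q*⊗1))` of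
the site∕unit objects with the averaging `Q(U) = Q⊗1 + D` ([B9] (3.48) shape; `D` = (3.80)'s `F₂(A)` when constructed). [cite: Balaban1985BackgroundPropagators, Thm 3.2 (3.48) p.398, (3.78)–(3.81) p.406 (shape)] -/
def zCovC (hL : Odd L ∧ 1 < L) (m kk r : ℕ) (A' : Fin (d + 1) → CvX' d L m kk r hL → Matrix mm mm ℂ)
    (D : (CvX d L m kk hL × ι → ℝ) →ₗ[ℝ] ((Tor (cvM d L m kk hL) × Fin (d + 1)) × ι → ℝ)) (E : ((Tor (cvM d L m kk hL) × Fin (d + 1)) × ι → ℝ) →ₗ[ℝ] (CvX d L m kk hL × ι → ℝ)) :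
    Matrix (B4.Idx (pbox (cvM d L m kk hL)) (d + 1) × ι) (B4.Idx (pbox (cvM d L m kk hL)) (d + 1) × ι) ℝ :=
  zLiveC d mm ι a e hL m kk r A' +
    unitBondMatC (cvM d L m kk hL) ι
      (D ∘ₗ cvGlued d L m kk hL a ((((L ^ kk : ℕ) : ℝ))⁻¹) ι e (fun _ _ => (1 : Matrix mm mm ℂ))
          (fun μ x => NormedSpace.exp (((((L ^ kk : ℕ) : ℝ))⁻¹) • gavgM (Matrix mm mm ℂ) (Fin (d + 1)) (kingPrV L kk r (cvM d L m kk hL)) A' μ x)) (cvNL d L m kk hL a ι) (fun _ => 0) ∘ₗ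
        (tensorId ι (qvAdjRe (cvM d L m kk hL) (L ^ kk)) + E)) +
    unitBondMatC (cvM d L m kk hL) ι
      (tensorId ι (qvRe (cvM d L m kk hL) (L ^ kk)) ∘ₗ cvGlued d L m kk hL a ((((L ^ kk : ℕ) : ℝ))⁻¹) ι e (fun _ _ => (1 : Matrix mm mm ℂ))
          (fun μ x => NormedSpace.exp (((((L ^ kk : ℕ) : ℝ))⁻¹) • gavgM (Matrix mm mm ℂ) (Fin (d + 1)) (kingPrV L kk r (cvM d L m kk hL)) A' μ x)) (cvNL d L m kk hL a ι) (fun _ => 0) ∘ₗ E)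

/-- **THE COVARIANTLY AVERAGED LIVE BACKGROUND MATRIX, FINE SPACING**, for averaging perturbations `D′`, `E′` at the fine spacing:
`zCovF A′ D′ E′ := zLiveF A′ + unitBondMatC(D′ ∘ X′(e^{η′A′}) ∘ (Q′*⊗1 + E′)) + unitBondMatC((Q′⊗1) ∘ X′(e^{η′A′}) ∘ E′)`. [cite: Balaban1985BackgroundPropagators, Thm 3.2 (3.48) p.398, (3.78)–(3.81) p.406 (shape)] -/
def zCovF (hL : Odd L ∧ 1 < L) (m kk r : ℕ) (A' : Fin (d + 1) → CvX' d L m kk r hL → Matrix mm mm ℂ)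
    (D' : (CvX' d L m kk r hL × ι → ℝ) →ₗ[ℝ] ((Tor (cvM d L m kk hL) × Fin (d + 1)) × ι → ℝ)) (E' : ((Tor (cvM d L m kk hL) × Fin (d + 1)) × ι → ℝ) →ₗ[ℝ] (CvX' d L m kk r hL × ι → ℝ)) :
    Matrix (B4.Idx (pbox (cvM d L m kk hL)) (d + 1) × ι) (B4.Idx (pbox (cvM d L m kk hL)) (d + 1) × ι) ℝ :=
  zLiveF d mm ι a e hL m kk r A' +
    unitBondMatC (cvM d L m kk hL) ι
      (D' ∘ₗ cvGlued' d L m kk r hL a ((((L ^ r * L ^ kk : ℕ) : ℝ))⁻¹) ι e (fun _ _ => (1 : Matrix mm mm ℂ)) (fun μ x' => NormedSpace.exp (((((L ^ r * L ^ kk : ℕ) : ℝ))⁻¹) • A' μ x'))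
          (cvNL' d L m kk r hL a ι) (fun _ => 0) ∘ₗ
        (tensorId ι (qvAdjRe (cvM d L m kk hL) (L ^ r * L ^ kk)) + E')) +
    unitBondMatC (cvM d L m kk hL) ι
      (tensorId ι (qvRe (cvM d L m kk hL) (L ^ r * L ^ kk)) ∘ₗ cvGlued' d L m kk r hL a ((((L ^ r * L ^ kk : ℕ) : ℝ))⁻¹) ι e (fun _ _ => (1 : Matrix mm mm ℂ))
          (fun μ x' => NormedSpace.exp (((((L ^ r * L ^ kk : ℕ) : ℝ))⁻¹) • A' μ x')) (cvNL' d L m kk r hL a ι) (fun _ => 0) ∘ₗ E')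

/-- At `D = E = 0` the covariantly averaged matrix is (J-b′)'s flat one: `zCovC A′ 0 0 = zLiveC A′`. [bookkeeping] -/
theorem zCovC_zero_zero (hL : Odd L ∧ 1 < L) (m kk r : ℕ) (A' : Fin (d + 1) → CvX' d L m kk r hL → Matrix mm mm ℂ) :
    zCovC d mm ι a e hL m kk r A' 0 0 = zLiveC d mm ι a e hL m kk r A' := by
  rw [zCovC, LinearMap.zero_comp, LinearMap.comp_zero, LinearMap.comp_zero, unitBondMatC_zero, add_zero, add_zero]

/-- At `D′ = E′ = 0`: `zCovF A′ 0 0 = zLiveF A′`. [bookkeeping] -/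
theorem zCovF_zero_zero (hL : Odd L ∧ 1 < L) (m kk r : ℕ) (A' : Fin (d + 1) → CvX' d L m kk r hL → Matrix mm mm ℂ) :
    zCovF d mm ι a e hL m kk r A' 0 0 = zLiveF d mm ι a e hL m kk r A' := by
  rw [zCovF, LinearMap.zero_comp, LinearMap.comp_zero, LinearMap.comp_zero, unitBondMatC_zero, add_zero, add_zero]

section Dictionary

variable {V W : Type} [AddCommGroup V] [Module ℝ V] [AddCommGroup W] [Module ℝ W]

omit [NeZero L] [Fintype mm] [DecidableEq mm] [Fintype ι] [DecidableEq ι] in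
/-- The algebra of the covariant sandwich: `(Q + D)X(A + E) − QGA = Q(X − G)A + (DX(A + E) + QXE)`. [folklore] -/
theorem covSandwich_sub_eq (Q D : V →ₗ[ℝ] W) (X G : V →ₗ[ℝ] V) (A E : W →ₗ[ℝ] V) :
    (Q + D) ∘ₗ X ∘ₗ (A + E) - Q ∘ₗ G ∘ₗ A = Q ∘ₗ (X - G) ∘ₗ A + (D ∘ₗ X ∘ₗ (A + E) + Q ∘ₗ X ∘ₗ E) := by
  simp only [LinearMap.add_comp, LinearMap.comp_add, LinearMap.comp_sub, LinearMap.sub_comp]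
  abel

end Dictionary

set_option maxRecDepth 8192 in
/-- ★ **THE HONEST DICTIONARY, COARSE SPACING**: `zCovC A′ D E = unitBondMatC((Q⊗1 + D) ∘ X(e^{ηĀ′}) ∘ (Q*⊗1 + E) − (Q⊗1)∘(G⊗1)∘(Q*⊗1))` — the middle factor of the (3.48)-shaped site object
with the averaging `Q⊗1 + D` ((J-c′) `siteC`'s `Z` when the flat `Q⊗1` is replaced by `Q⊗1 + D`). [cite: Balaban1985BackgroundPropagators, Thm 3.2 (3.48) p.398 (shape); Balaban1984PropagatorsI, (1.102)–(1.103) p.34] -/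
theorem zCovC_eq (hL : Odd L ∧ 1 < L) (m kk r : ℕ) (A' : Fin (d + 1) → CvX' d L m kk r hL → Matrix mm mm ℂ)
    (D : (CvX d L m kk hL × ι → ℝ) →ₗ[ℝ] ((Tor (cvM d L m kk hL) × Fin (d + 1)) × ι → ℝ)) (E : ((Tor (cvM d L m kk hL) × Fin (d + 1)) × ι → ℝ) →ₗ[ℝ] (CvX d L m kk hL × ι → ℝ)) :
    zCovC d mm ι a e hL m kk r A' D E =
      unitBondMatC (cvM d L m kk hL) ι
        ((tensorId ι (qvRe (cvM d L m kk hL) (L ^ kk)) + D) ∘ₗ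
            cvGlued d L m kk hL a ((((L ^ kk : ℕ) : ℝ))⁻¹) ι e (fun _ _ => (1 : Matrix mm mm ℂ))
              (fun μ x => NormedSpace.exp (((((L ^ kk : ℕ) : ℝ))⁻¹) • gavgM (Matrix mm mm ℂ) (Fin (d + 1)) (kingPrV L kk r (cvM d L m kk hL)) A' μ x)) (cvNL d L m kk hL a ι) (fun _ => 0) ∘ₗ
          (tensorId ι (qvAdjRe (cvM d L m kk hL) (L ^ kk)) + E) -
          tensorId ι (qvRe (cvM d L m kk hL) (L ^ kk)) ∘ₗ tensorId ι (gOp (cvM d L m kk hL) (L ^ kk) a) ∘ₗ tensorId ι (qvAdjRe (cvM d L m kk hL) (L ^ kk))) := by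
  rw [covSandwich_sub_eq, unitBondMatC_add, unitBondMatC_add, zCovC, zLiveC, add_assoc]

set_option maxRecDepth 8192 in
/-- ★ **THE HONEST DICTIONARY, FINE SPACING**: `zCovF A′ D′ E′ = unitBondMatC((Q′⊗1 + D′) ∘ X′(e^{η′A′}) ∘ (Q′*⊗1 + E′) − (Q′⊗1)∘(G′⊗1)∘(Q′*⊗1))`.
[cite: Balaban1985BackgroundPropagators, Thm 3.2 (3.48) p.398 (shape); Balaban1984PropagatorsI, (1.102)–(1.103) p.34] -/
theorem zCovF_eq (hL : Odd L ∧ 1 < L) (m kk r : ℕ) (A' : Fin (d + 1) → CvX' d L m kk r hL → Matrix mm mm ℂ)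
    (D' : (CvX' d L m kk r hL × ι → ℝ) →ₗ[ℝ] ((Tor (cvM d L m kk hL) × Fin (d + 1)) × ι → ℝ)) (E' : ((Tor (cvM d L m kk hL) × Fin (d + 1)) × ι → ℝ) →ₗ[ℝ] (CvX' d L m kk r hL × ι → ℝ)) :
    zCovF d mm ι a e hL m kk r A' D' E' =
      unitBondMatC (cvM d L m kk hL) ι
        ((tensorId ι (qvRe (cvM d L m kk hL) (L ^ r * L ^ kk)) + D') ∘ₗ
            cvGlued' d L m kk r hL a ((((L ^ r * L ^ kk : ℕ) : ℝ))⁻¹) ι e (fun _ _ => (1 : Matrix mm mm ℂ)) (fun μ x' => NormedSpace.exp (((((L ^ r * L ^ kk : ℕ) : ℝ))⁻¹) • A' μ x'))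
              (cvNL' d L m kk r hL a ι) (fun _ => 0) ∘ₗ
          (tensorId ι (qvAdjRe (cvM d L m kk hL) (L ^ r * L ^ kk)) + E') -
          tensorId ι (qvRe (cvM d L m kk hL) (L ^ r * L ^ kk)) ∘ₗ tensorId ι (gOp (cvM d L m kk hL) (L ^ r * L ^ kk) a) ∘ₗ tensorId ι (qvAdjRe (cvM d L m kk hL) (L ^ r * L ^ kk))) := by
  rw [covSandwich_sub_eq, unitBondMatC_add, unitBondMatC_add, zCovF, zLiveF, add_assoc]

/-! ## §2a Two scalar amplitude budgets (kept out of the operator context) -/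

/-- Amplitude budget of letters (i)(ii): `K_Z·κr + ρ_D·B·(e₀ + ρ_E)·c + e₀·B·ρ_E·c ≤ K·(κr + ρ_D + ρ_E)` once `K ≥ K_Z + c((6e₀+2)B + (2e₀+1)A(1+R₁))` (`ρ_D, ρ_E ≤ 1`). [folklore] -/
theorem amp_size_le {KZ κr ρD ρE BX e₀ A R₁ c K : ℝ} (hKZ : 0 ≤ KZ) (hκr : 0 ≤ κr) (hρD : 0 ≤ ρD) (hρE : 0 ≤ ρE) (hρE1 : ρE ≤ 1) (hBX : 0 ≤ BX) (he₀ : 0 ≤ e₀)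
    (hA : 0 ≤ A) (hR₁ : 0 ≤ R₁) (hc : 0 ≤ c) (hK : KZ + c * ((6 * e₀ + 2) * BX + (2 * e₀ + 1) * A * (1 + R₁)) ≤ K) :
    KZ * κr + ρD * BX * (1 * e₀ + ρE) * c + 1 * e₀ * BX * ρE * c ≤ K * (κr + ρD + ρE) := by
  have hK1 : KZ ≤ K := by
    have : 0 ≤ c * ((6 * e₀ + 2) * BX + (2 * e₀ + 1) * A * (1 + R₁)) := by positivity
    linarith
  have hK2 : BX * (e₀ + 1) * c ≤ K := by
    have h5 : BX * (e₀ + 1) ≤ (6 * e₀ + 2) * BX + (2 * e₀ + 1) * A * (1 + R₁) := by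
      have h6 : 0 ≤ (2 * e₀ + 1) * A * (1 + R₁) := by positivity
      have h7 : 0 ≤ BX * e₀ := mul_nonneg hBX he₀
      linarith
    have h8 := mul_le_mul_of_nonneg_right h5 hc
    linarith
  have h1 : ρD * BX * (1 * e₀ + ρE) * c ≤ ρD * (BX * (e₀ + 1) * c) := by
    have h := mul_le_mul_of_nonneg_left (show 1 * e₀ + ρE ≤ e₀ + 1 by linarith) (show 0 ≤ ρD * BX * c by positivity)
    linarith
  have h2 : 1 * e₀ * BX * ρE * c ≤ ρE * (BX * (e₀ + 1) * c) := by
    have h : 0 ≤ ρE * BX * c := by positivity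
    linarith
  linarith [mul_le_mul_of_nonneg_right hK1 hκr, mul_le_mul_of_nonneg_left hK2 hρD, mul_le_mul_of_nonneg_left hK2 hρE]

/-- Amplitude budget of letter (iii): the seven defect amplitudes against `K·(θ + κη + τ_D + τ_E)` (`η ≤ θ`, `ρ_D, ρ_E ≤ 1`, `K ≥ K_Z + c((6e₀+2)B + (2e₀+1)A(1+R₁))`). [folklore] -/
theorem amp_defect_le {KZ θ κη η τD τE ρD ρE BX e₀ A R₁ c K : ℝ}
    (hKZ : 0 ≤ KZ) (hθ : 0 ≤ θ) (hκη : 0 ≤ κη) (hη : 0 ≤ η) (hηθ : η ≤ θ) (hτD : 0 ≤ τD) (hτE : 0 ≤ τE) (hρD1 : ρD ≤ 1) (hρE : 0 ≤ ρE)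
    (hρE1 : ρE ≤ 1) (hBX : 0 ≤ BX) (he₀ : 0 ≤ e₀) (hA : 0 ≤ A) (hR₁ : 0 ≤ R₁) (hc : 0 ≤ c) (hK : KZ + c * ((6 * e₀ + 2) * BX + (2 * e₀ + 1) * A * (1 + R₁)) ≤ K) :
    KZ * (θ + κη) + c * (ρD * BX * (2 * e₀ * η + τE) + ρD * (1 * e₀ + ρE) * (A * (θ + R₁ * κη)) + BX * (1 * e₀ + ρE) * τD) +
      c * (1 * e₀ * BX * τE + 1 * e₀ * ρE * (A * (θ + R₁ * κη)) + BX * ρE * (2 * e₀ * η)) ≤ K * (θ + κη + τD + τE) := by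
  have hU0 : 0 ≤ θ + κη + τD + τE := by positivity
  have hθU : θ ≤ θ + κη + τD + τE := by linarith
  have hηU : η ≤ θ + κη + τD + τE := hηθ.trans hθU
  have hκU : κη ≤ θ + κη + τD + τE := by linarith
  have hτDU : τD ≤ θ + κη + τD + τE := by linarith
  have hτEU : τE ≤ θ + κη + τD + τE := by linarith
  have hIU : θ + R₁ * κη ≤ (1 + R₁) * (θ + κη + τD + τE) := by
    have h := mul_le_mul_of_nonneg_left hκU hR₁
    linarith
  have hI0 : 0 ≤ A * (θ + R₁ * κη) := by positivity
  have hq2 : 0 ≤ 1 * e₀ + ρE := by positivity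
  have hq2' : 1 * e₀ + ρE ≤ e₀ + 1 := by linarith
  have t1 : KZ * (θ + κη) ≤ KZ * (θ + κη + τD + τE) := mul_le_mul_of_nonneg_left (by linarith) hKZ
  have t2 : ρD * BX * (2 * e₀ * η + τE) ≤ BX * (2 * e₀ + 1) * (θ + κη + τD + τE) := by
    have h23 : 2 * e₀ * η + τE ≤ (2 * e₀ + 1) * (θ + κη + τD + τE) := by
      have h := mul_le_mul_of_nonneg_left hηU (show 0 ≤ 2 * e₀ by positivity)
      linarith
    have hA' := mul_le_mul_of_nonneg_left h23 hBX
    have hB' := mul_le_of_le_one_left (show 0 ≤ BX * (2 * e₀ * η + τE) by positivity) hρD1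
    linarith
  have t3 : ρD * (1 * e₀ + ρE) * (A * (θ + R₁ * κη)) ≤ (e₀ + 1) * A * (1 + R₁) * (θ + κη + τD + τE) := by
    have h3a : A * (θ + R₁ * κη) ≤ A * ((1 + R₁) * (θ + κη + τD + τE)) := mul_le_mul_of_nonneg_left hIU hA
    have h3b : ρD * (1 * e₀ + ρE) ≤ e₀ + 1 := by
      have h := mul_le_of_le_one_left hq2 hρD1
      linarith
    have h := mul_le_mul h3b h3a hI0 (by positivity)
    linarith
  have t4 : BX * (1 * e₀ + ρE) * τD ≤ BX * (e₀ + 1) * (θ + κη + τD + τE) :=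
    mul_le_mul (mul_le_mul_of_nonneg_left hq2' hBX) hτDU hτD (by positivity)
  have t5 : 1 * e₀ * BX * τE ≤ e₀ * BX * (θ + κη + τD + τE) := by
    have h := mul_le_mul_of_nonneg_left hτEU (show 0 ≤ e₀ * BX by positivity)
    linarith
  have t6 : 1 * e₀ * ρE * (A * (θ + R₁ * κη)) ≤ e₀ * A * (1 + R₁) * (θ + κη + τD + τE) := by
    have h3a : A * (θ + R₁ * κη) ≤ A * ((1 + R₁) * (θ + κη + τD + τE)) := mul_le_mul_of_nonneg_left hIU hA
    have h6b : 1 * e₀ * ρE ≤ e₀ := by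
      have h := mul_le_of_le_one_right (show 0 ≤ 1 * e₀ by positivity) hρE1
      linarith
    have h := mul_le_mul h6b h3a hI0 he₀
    linarith
  have t7 : BX * ρE * (2 * e₀ * η) ≤ 2 * e₀ * BX * (θ + κη + τD + τE) := by
    have h := mul_le_mul_of_nonneg_left (mul_le_mul hρE1 hηU hη zero_le_one) (show 0 ≤ 2 * e₀ * BX by positivity)
    linarith
  have hs2 := mul_le_mul_of_nonneg_left (show ρD * BX * (2 * e₀ * η + τE) + ρD * (1 * e₀ + ρE) * (A * (θ + R₁ * κη)) + BX * (1 * e₀ + ρE) * τD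
      ≤ (BX * (2 * e₀ + 1) + (e₀ + 1) * A * (1 + R₁) + BX * (e₀ + 1)) * (θ + κη + τD + τE) by linarith) hc
  have hs3 := mul_le_mul_of_nonneg_left (show 1 * e₀ * BX * τE + 1 * e₀ * ρE * (A * (θ + R₁ * κη)) + BX * ρE * (2 * e₀ * η)
      ≤ (e₀ * BX + e₀ * A * (1 + R₁) + 2 * e₀ * BX) * (θ + κη + τD + τE) by linarith) hc
  have hKU := mul_le_mul_of_nonneg_right hK hU0
  linarith

end Summit.QuantumFields.YangMills.BalabanUVNodes.N15.GluedZeroField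

end
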